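import Summits.KontsevichZagierPeriods.KontsevichZagierPeriods.Theorems.MzvKernelInKZTwoPosetsInteriorLandenAux1
import Literature.NumberTheory.Transcendental.KZCalculus

/-!
# `MzvKernelInKZ` (stmt-KontsevichZagierPeriods-3914), line two-posets-interior-landen: stub `stub_interiorLanden`, tools II

Second support file of the stub `stub_interiorLanden` (the interior Landen identity `E′` with
spectators as a chain of moves of the Kontsevich–Zagier calculus; assembled in
`MzvKernelInKZTwoPosetsInteriorLanden.lean`). No definitions are introduced (file-local notation
only, the same as in tools I). In the coordinates `v = x 0`, spectators, `r = x (m+1)`, modulus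
`y = ∏ x (i+1)` on `(0,1)^{m+2}`:

* **Move 4 map** `Φ₄ (v, p, r) = (v, p, v r)`: a bijection `cube → D_A = {r < v}`
  (`stub_interiorLandenAux2`), `ℚ`-polynomial, Jacobian determinant `v`.
* **Move 2 map**, the fibrewise Möbius involution `Φ₂ (v, p, r) = (φ_y v, p, φ_y r)`,
  `φ_y(t) = (1-t)/(1-yt)`: an involution of the cube exchanging `D_A` and `D_B = {v < r}`,
  `ℚ`-semialgebraic, differentiable with `|det Φ₂'| = (1 - y)² / ((1 - y v)² (1 - y r)²)` — it
  is the composite of the two one-coordinate substitutions `v ↦ φ_y v` and `r ↦ φ_y r`, so the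
  chain rule and the one-variable derivative of `φ_y` give the Jacobian.
* **The integrands** of the chain — `A = 1/((1-yv)(1-r))`, `B = 1/((1-yv) r (1-yr))`,
  `B₁ = 1/((1-yv) r)`, `B₂ = y/((1-yv)(1-yr))`, `C' = 1/(v(1-yv)(1-yr))` — are `ℚ`-semialgebraic
  on subsets of the cube (quotients of `ℚ`-polynomials with non-vanishing denominators); after the
  swap of the two fibre coordinates `C'` becomes `B`.

References: M. Kontsevich, D. Zagier, *Periods* (2001), §1.2 rule (2); M. Kaneko, S. Yamamoto,
*A new integral–series identity of multiple zeta values and regularizations* (2018), §4.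
-/

noncomputable section

namespace Summit.KontsevichZagierPeriods.MzvKernelInKZ.TwoPosets.Landen

open Set MeasureTheory
open Literature.NumberTheory.Transcendental

/-- The identity matrix with the `k`-th row replaced by `g'`, as a continuous linear map. -/
local notation "updD⟪" k ", " g' "⟫" => ContinuousLinearMap.pi
  (Function.update (fun i => ContinuousLinearMap.proj (R := ℝ) (φ := fun _ => ℝ) i) k g')

/-- `φ_y(t) = (1 - t) / (1 - y t)`. -/
local notation "φ⟪" y ", " t "⟫" => (1 - t) / (1 - y * t)

/-- The modulus `y = p₁ ⋯ p_m`. -/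
local notation "ymod⟪" m ", " x "⟫" => ∏ i : Fin m, x (Fin.castSucc (Fin.succ i))

set_option quotPrecheck false in
/-- The open cube `(0,1)^{m+2}`. -/
local notation "cub⟪" m "⟫" => {x : Fin (m + 2) → ℝ | ∀ i, 0 < x i ∧ x i < 1}

set_option quotPrecheck false in
/-- `D_A = {x ∈ (0,1)^{m+2} | r < v}`. -/
local notation "DA⟪" m "⟫" =>
  {x : Fin (m + 2) → ℝ | (∀ i, 0 < x i ∧ x i < 1) ∧ x (Fin.last (m + 1)) < x 0}

set_option quotPrecheck false in
/-- `D_B = {x ∈ (0,1)^{m+2} | v < r}`. -/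
local notation "DB⟪" m "⟫" =>
  {x : Fin (m + 2) → ℝ | (∀ i, 0 < x i ∧ x i < 1) ∧ x 0 < x (Fin.last (m + 1))}

/-- The modulus polynomial `∏ X_{i+1}` over `ℚ`. -/
local notation "Ypoly⟪" m "⟫" =>
  ∏ i : Fin m, (MvPolynomial.X (Fin.castSucc (Fin.succ i)) : MvPolynomial (Fin (m + 2)) ℚ)

/-- The move-1 map `Φ₁ (v, p, r) = (v, p, r/v)`. -/
local notation "Φ₁⟪" m "⟫" => fun x : Fin (m + 2) → ℝ =>
  Function.update x (Fin.last (m + 1)) (x (Fin.last (m + 1)) / x 0)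

/-- The move-4 map `Φ₄ (v, p, r) = (v, p, v r)` (the substitution `ρ = v r`). -/
local notation "Φ₄⟪" m "⟫" => fun x : Fin (m + 2) → ℝ =>
  Function.update x (Fin.last (m + 1)) (x 0 * x (Fin.last (m + 1)))

/-- The move-2 map, the fibrewise Möbius involution `Φ₂ (v, p, r) = (φ_y v, p, φ_y r)`. -/
local notation "Φ₂⟪" m "⟫" => fun x : Fin (m + 2) → ℝ =>
  Function.update (Function.update x 0 φ⟪ymod⟪m, x⟫, x 0⟫) (Fin.last (m + 1))
    φ⟪ymod⟪m, x⟫, x (Fin.last (m + 1))⟫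

/-- The swap of the two fibre coordinates. -/
local notation "swp⟪" m "⟫" => Equiv.swap (0 : Fin (m + 2)) (Fin.last (m + 1))

/-- `A = 1 / ((1 - y v)(1 - r))`. -/
local notation "fa⟪" m ", " x "⟫" => 1 / ((1 - ymod⟪m, x⟫ * x 0) * (1 - x (Fin.last (m + 1))))

/-- `B = 1 / ((1 - y v) r (1 - y r))`. -/
local notation "fb⟪" m ", " x "⟫" =>
  1 / ((1 - ymod⟪m, x⟫ * x 0) * x (Fin.last (m + 1)) * (1 - ymod⟪m, x⟫ * x (Fin.last (m + 1))))

/-- `B₁ = C₁ = 1 / ((1 - y v) r)`. -/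
local notation "fb1⟪" m ", " x "⟫" => 1 / ((1 - ymod⟪m, x⟫ * x 0) * x (Fin.last (m + 1)))

/-- `B₂ = C₂ = y / ((1 - y v)(1 - y r))`. -/
local notation "fb2⟪" m ", " x "⟫" =>
  ymod⟪m, x⟫ / ((1 - ymod⟪m, x⟫ * x 0) * (1 - ymod⟪m, x⟫ * x (Fin.last (m + 1))))

/-- `C' = 1 / (v (1 - y v)(1 - y r))`. -/
local notation "fc⟪" m ", " x "⟫" =>
  1 / (x 0 * (1 - ymod⟪m, x⟫ * x 0) * (1 - ymod⟪m, x⟫ * x (Fin.last (m + 1))))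

variable {m : ℕ}

/-! ### Move 4 map `Φ₄ (v, p, r) = (v, p, v r) : cube → D_A` -/

/-- `Φ₄` maps the cube into `D_A`. -/
theorem Phi4_mem_DA {x : Fin (m + 2) → ℝ} (hx : x ∈ cub⟪m⟫) : Φ₄⟪m⟫ x ∈ DA⟪m⟫ := by
  refine ⟨fun i => ?_, ?_⟩
  · by_cases hi : i = Fin.last (m + 1)
    · subst hi
      simp only [Function.update_self]
      exact ⟨mul_pos (hx _).1 (hx _).1,
        mul_lt_one_of_nonneg_of_lt_one_left (hx _).1.le (hx _).2 (hx _).2.le⟩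
    · simp only [Function.update_of_ne hi]; exact hx i
  · simp only [Function.update_self, Function.update_of_ne zero_ne_last]
    exact mul_lt_of_lt_one_right (hx _).1 (hx _).2

/-- `Φ₄` maps the cube onto `D_A` (its inverse there is `Φ₁`). -/
theorem image_Phi4 : Φ₄⟪m⟫ '' cub⟪m⟫ = DA⟪m⟫ := by
  refine Subset.antisymm ?_ ?_
  · rintro _ ⟨x, hx, rfl⟩; exact Phi4_mem_DA hx
  · intro z hz
    refine ⟨Φ₁⟪m⟫ z, Phi1_mem_cub hz, ?_⟩
    funext i
    by_cases hi : i = Fin.last (m + 1)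
    · subst hi
      simp only [Function.update_self, Function.update_of_ne zero_ne_last]
      field_simp [(hz.1 0).1.ne']
    · simp only [Function.update_of_ne hi]

/-- `Φ₄` is injective on the cube. -/
theorem injOn_Phi4 : InjOn Φ₄⟪m⟫ cub⟪m⟫ := by
  intro x hx z hz h
  have h0 : x 0 = z 0 := by
    simpa only [Function.update_of_ne zero_ne_last] using congrFun h 0
  funext i
  by_cases hi : i = Fin.last (m + 1)
  · subst hi
    have := congrFun h (Fin.last (m + 1))
    simp only [Function.update_self] at this
    rw [h0] at this
    exact mul_left_cancel₀ (hz 0).1.ne' this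
  · simpa only [Function.update_of_ne hi] using congrFun h i

/-- `Φ₄` is a `ℚ`-polynomial map, hence `ℚ`-semialgebraic on the cube. -/
theorem isSemialgebraicMapOn_Phi4 : IsSemialgebraicMapOn ℚ cub⟪m⟫ Φ₄⟪m⟫ := by
  refine (isSemialgebraicMapOn_aeval isSemialgebraic_cub fun j =>
    if j = Fin.last (m + 1) then MvPolynomial.X 0 * MvPolynomial.X (Fin.last (m + 1))
    else MvPolynomial.X j).congr fun x _ => ?_
  funext j
  by_cases hj : j = Fin.last (m + 1)
  · subst hj; simp
  · simp [hj]

/-- `Φ₄` is differentiable with Jacobian determinant `x_0` (a one-coordinate substitution). -/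
theorem hasFDerivAt_Phi4 : ∃ D : (Fin (m + 2) → ℝ) → ((Fin (m + 2) → ℝ) →L[ℝ] (Fin (m + 2) → ℝ)),
    ∀ x : Fin (m + 2) → ℝ, HasFDerivAt Φ₄⟪m⟫ (D x) x ∧ (D x).det = x 0 := by
  refine ⟨fun x => updD⟪Fin.last (m + 1),
    fderiv ℝ (fun y : Fin (m + 2) → ℝ => y 0 * y (Fin.last (m + 1))) x⟫, fun x => ?_⟩
  have hg : DifferentiableAt ℝ (fun y : Fin (m + 2) → ℝ => y 0 * y (Fin.last (m + 1))) x :=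
    (differentiableAt_apply 0 x).mul (differentiableAt_apply _ x)
  have hd : HasDerivAt (fun t => (Function.update x (Fin.last (m + 1)) t) 0 *
      (Function.update x (Fin.last (m + 1)) t) (Fin.last (m + 1))) (x 0) (x (Fin.last (m + 1))) := by
    simp only [Function.update_self, Function.update_of_ne zero_ne_last]
    simpa using (hasDerivAt_id (x (Fin.last (m + 1)))).const_mul (x 0)
  exact hasFDerivAt_update_det (Fin.last (m + 1)) hg hd

/-- **Principal statement of this file** (registered support of `stub_interiorLanden`): the
substitution `ρ = v r`, i.e. `x ↦ update x last (x_0 · x_last)`, maps the open cube `(0,1)^{m+2}`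
onto the half-cube `{x_last < x_0}`. -/
theorem stub_interiorLandenAux2 : ∀ (m : ℕ), (fun x : Fin (m + 2) → ℝ => Function.update x (Fin.last (m + 1)) (x 0 * x (Fin.last (m + 1)))) '' {x | ∀ i, 0 < x i ∧ x i < 1} = {x | (∀ i, 0 < x i ∧ x i < 1) ∧ x (Fin.last (m + 1)) < x 0} :=
  fun _ => image_Phi4

/-! ### Move 2 map: the fibrewise Möbius involution `Φ₂` -/

/-- `Φ₂` does not change the modulus. -/
theorem ymod_Phi2 (x : Fin (m + 2) → ℝ) : ymod⟪m, Φ₂⟪m⟫ x⟫ = ymod⟪m, x⟫ := by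
  simp only [ymod_update_last, ymod_update_zero]

/-- `Φ₂` preserves the cube. -/
theorem Phi2_mem_cub (hm : 1 ≤ m) {x : Fin (m + 2) → ℝ} (hx : x ∈ cub⟪m⟫) : Φ₂⟪m⟫ x ∈ cub⟪m⟫ := by
  obtain ⟨h0, h0', hl, hl', -, hy', -, -⟩ := cub_facts hm hx
  intro i
  by_cases hil : i = Fin.last (m + 1)
  · subst hil; simp only [Function.update_self]; exact ⟨phi_pos hy' hl hl', phi_lt_one hy' hl hl'⟩
  by_cases hi0 : i = 0
  · subst hi0
    simp only [Function.update_of_ne zero_ne_last, Function.update_self]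
    exact ⟨phi_pos hy' h0 h0', phi_lt_one hy' h0 h0'⟩
  simp only [Function.update_of_ne hil, Function.update_of_ne hi0]; exact hx i

/-- `Φ₂` is an involution of the cube. -/
theorem Phi2_Phi2 (hm : 1 ≤ m) {x : Fin (m + 2) → ℝ} (hx : x ∈ cub⟪m⟫) : Φ₂⟪m⟫ (Φ₂⟪m⟫ x) = x := by
  obtain ⟨-, -, -, -, -, hy', h1, h2⟩ := cub_facts hm hx
  funext i
  simp only [ymod_update_last, ymod_update_zero]
  by_cases hil : i = Fin.last (m + 1)
  · subst hil; simp only [Function.update_self]; exact phi_phi hy'.ne h2.ne'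
  by_cases hi0 : i = 0
  · subst hi0
    simp only [Function.update_of_ne zero_ne_last, Function.update_self]
    exact phi_phi hy'.ne h1.ne'
  simp only [Function.update_of_ne hil, Function.update_of_ne hi0]

/-- `Φ₂` maps `D_A` into `D_B` (it reverses the order of the fibre coordinates). -/
theorem Phi2_mem_DB (hm : 1 ≤ m) {x : Fin (m + 2) → ℝ} (hx : x ∈ DA⟪m⟫) : Φ₂⟪m⟫ x ∈ DB⟪m⟫ := by
  obtain ⟨h0, h0', hl, hl', -, hy', -, -⟩ := cub_facts hm hx.1
  refine ⟨Phi2_mem_cub hm hx.1, ?_⟩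
  simp only [Function.update_self, Function.update_of_ne zero_ne_last]
  exact phi_lt_phi hy' hl hl' h0 h0' hx.2

/-- `Φ₂` maps `D_B` into `D_A`. -/
theorem Phi2_mem_DA (hm : 1 ≤ m) {x : Fin (m + 2) → ℝ} (hx : x ∈ DB⟪m⟫) : Φ₂⟪m⟫ x ∈ DA⟪m⟫ := by
  obtain ⟨h0, h0', hl, hl', -, hy', -, -⟩ := cub_facts hm hx.1
  refine ⟨Phi2_mem_cub hm hx.1, ?_⟩
  simp only [Function.update_self, Function.update_of_ne zero_ne_last]
  exact phi_lt_phi hy' h0 h0' hl hl' hx.2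

/-- `Φ₂` maps `D_A` onto `D_B`. -/
theorem image_Phi2 (hm : 1 ≤ m) : Φ₂⟪m⟫ '' DA⟪m⟫ = DB⟪m⟫ := by
  refine Subset.antisymm ?_ ?_
  · rintro _ ⟨x, hx, rfl⟩; exact Phi2_mem_DB hm hx
  · intro z hz
    exact ⟨Φ₂⟪m⟫ z, Phi2_mem_DA hm hz, Phi2_Phi2 hm hz.1⟩

/-- `Φ₂` is injective on `D_A`. -/
theorem injOn_Phi2 (hm : 1 ≤ m) : InjOn Φ₂⟪m⟫ DA⟪m⟫ := by
  intro x hx z hz h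
  rw [← Phi2_Phi2 hm hx.1, ← Phi2_Phi2 hm hz.1]
  exact congrArg Φ₂⟪m⟫ h

/-- `Φ₂` is a quotient of `ℚ`-polynomials coordinatewise, hence `ℚ`-semialgebraic on `D_A`. -/
theorem isSemialgebraicMapOn_Phi2 (hm : 1 ≤ m) : IsSemialgebraicMapOn ℚ DA⟪m⟫ Φ₂⟪m⟫ := by
  refine IsSemialgebraicMapOn.of_forall isSemialgebraic_DA fun j => ?_
  by_cases hjl : j = Fin.last (m + 1)
  · subst hjl
    refine (isSemialgebraicFunOn_aeval_div_aeval isSemialgebraic_DA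
      (1 - MvPolynomial.X (Fin.last (m + 1))) (1 - Ypoly⟪m⟫ * MvPolynomial.X (Fin.last (m + 1)))
      fun x hx => ?_).congr fun x hx => ?_
    · simpa [map_prod] using (cub_facts hm hx.1).2.2.2.2.2.2.2.ne'
    · simp [map_prod]
  by_cases hj0 : j = 0
  · subst hj0
    refine (isSemialgebraicFunOn_aeval_div_aeval isSemialgebraic_DA (1 - MvPolynomial.X 0)
      (1 - Ypoly⟪m⟫ * MvPolynomial.X 0) fun x hx => ?_).congr fun x hx => ?_
    · simpa [map_prod] using (cub_facts hm hx.1).2.2.2.2.2.2.1.ne'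
    · simp [map_prod]
  · refine (isSemialgebraicFunOn_aeval isSemialgebraic_DA (MvPolynomial.X j)).congr fun x hx => ?_
    simp [Function.update_of_ne hjl, Function.update_of_ne hj0]

/-- `Φ₂` is differentiable on the cube with `|det Φ₂'| = (1-y)²/((1-y x_0)²(1-y x_last)²)`: it is
the composite of the one-coordinate substitutions `v ↦ φ_y v` and `r ↦ φ_y r` (chain rule). -/
theorem hasFDerivAt_Phi2 (hm : 1 ≤ m) :
    ∃ D : (Fin (m + 2) → ℝ) → ((Fin (m + 2) → ℝ) →L[ℝ] (Fin (m + 2) → ℝ)), ∀ x ∈ cub⟪m⟫,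
      HasFDerivAt Φ₂⟪m⟫ (D x) x ∧ |(D x).det| = (1 - ymod⟪m, x⟫) ^ 2 /
        ((1 - ymod⟪m, x⟫ * x 0) ^ 2 * (1 - ymod⟪m, x⟫ * x (Fin.last (m + 1))) ^ 2) := by
  -- the two one-coordinate substitutions and their derivative fields
  let gF : (Fin (m + 2) → ℝ) → ℝ := fun y => φ⟪ymod⟪m, y⟫, y 0⟫
  let gG : (Fin (m + 2) → ℝ) → ℝ := fun y => φ⟪ymod⟪m, y⟫, y (Fin.last (m + 1))⟫
  let F : (Fin (m + 2) → ℝ) → (Fin (m + 2) → ℝ) := fun y => Function.update y 0 (gF y)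
  let DF : (Fin (m + 2) → ℝ) → ((Fin (m + 2) → ℝ) →L[ℝ] (Fin (m + 2) → ℝ)) :=
    fun x => updD⟪0, fderiv ℝ gF x⟫
  let DG : (Fin (m + 2) → ℝ) → ((Fin (m + 2) → ℝ) →L[ℝ] (Fin (m + 2) → ℝ)) :=
    fun x => updD⟪Fin.last (m + 1), fderiv ℝ gG x⟫
  refine ⟨fun x => (DG (F x)).comp (DF x), fun x hx => ?_⟩
  obtain ⟨h0, h0', hl, hl', -, hy', h1, h2⟩ := cub_facts hm hx
  -- F
  have hgF : DifferentiableAt ℝ gF x :=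
    differentiableAt_div ((differentiableAt_const _).sub (differentiableAt_apply 0 x))
      ((differentiableAt_const _).sub ((differentiableAt_prod_coord _ x).mul
        (differentiableAt_apply 0 x))) h1.ne'
  have hdF : HasDerivAt (fun t => gF (Function.update x 0 t))
      (-(1 - ymod⟪m, x⟫) / (1 - ymod⟪m, x⟫ * x 0) ^ 2) (x 0) := by
    simp only [gF, Function.update_self, ymod_update_zero]
    exact hasDerivAt_phi h1.ne'
  obtain ⟨hF, hdetF⟩ := hasFDerivAt_update_det 0 hgF hdF
  -- G at F x
  have eFl : F x (Fin.last (m + 1)) = x (Fin.last (m + 1)) :=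
    Function.update_of_ne (Ne.symm zero_ne_last) _ _
  have eFy : ymod⟪m, F x⟫ = ymod⟪m, x⟫ := ymod_update_zero _ _
  have hgG : DifferentiableAt ℝ gG (F x) := by
    refine differentiableAt_div ((differentiableAt_const _).sub (differentiableAt_apply _ _))
      ((differentiableAt_const _).sub ((differentiableAt_prod_coord _ _).mul
        (differentiableAt_apply _ _))) ?_
    rw [eFl, eFy]; exact h2.ne'
  have hdG : HasDerivAt (fun t => gG (Function.update (F x) (Fin.last (m + 1)) t))
      (-(1 - ymod⟪m, x⟫) / (1 - ymod⟪m, x⟫ * x (Fin.last (m + 1))) ^ 2)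
      ((F x) (Fin.last (m + 1))) := by
    simp only [gG, Function.update_self, ymod_update_last]
    rw [eFl, eFy]
    exact hasDerivAt_phi h2.ne'
  obtain ⟨hG, hdetG⟩ := hasFDerivAt_update_det (Fin.last (m + 1)) hgG hdG
  -- the composite is `Φ₂`
  have hcomp := hG.comp x hF
  have heq : ((fun y => Function.update y (Fin.last (m + 1)) (gG y)) ∘ F) = Φ₂⟪m⟫ := by
    funext y
    simp only [Function.comp_apply, F, gG, gF, ymod_update_zero,
      Function.update_of_ne (Ne.symm zero_ne_last)]
  rw [heq] at hcomp
  refine ⟨hcomp, ?_⟩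
  have hdet : ((DG (F x)).comp (DF x)).det = (DG (F x)).det * (DF x).det := by
    change LinearMap.det (((DG (F x)) : (Fin (m + 2) → ℝ) →ₗ[ℝ] (Fin (m + 2) → ℝ)).comp
      ((DF x) : (Fin (m + 2) → ℝ) →ₗ[ℝ] (Fin (m + 2) → ℝ))) = _
    rw [LinearMap.det_comp]
  rw [hdet, abs_mul]
  change |(updD⟪Fin.last (m + 1), fderiv ℝ gG (F x)⟫ : (Fin (m + 2) → ℝ) →L[ℝ] _).det| *
    |(updD⟪0, fderiv ℝ gF x⟫ : (Fin (m + 2) → ℝ) →L[ℝ] _).det| = _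
  rw [hdetG, hdetF, abs_deriv_phi hy' hl hl', abs_deriv_phi hy' h0 h0']
  field_simp

/-! ### Semialgebraicity of the integrands on subsets of the cube -/

section sa
open MvPolynomial

variable (hm : 1 ≤ m) {S : Set (Fin (m + 2) → ℝ)}
  (hS : Literature.ModelTheory.ExponentialFields.IsSemialgebraic ℚ S) (hsub : S ⊆ cub⟪m⟫)
include hm hS hsub

/-- `A` is `ℚ`-semialgebraic on any `ℚ`-semialgebraic subset of the cube. -/
theorem sa_fa : IsSemialgebraicFunOn ℚ S (fun x => fa⟪m, x⟫) := by
  refine (isSemialgebraicFunOn_aeval_div_aeval hS 1 ((1 - Ypoly⟪m⟫ * X 0) * (1 - X (Fin.last (m + 1))))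
    fun x hx => ?_).congr fun x hx => ?_
  · obtain ⟨-, -, -, hl', -, -, h1, -⟩ := cub_facts hm (hsub hx)
    simp only [map_mul, map_sub, map_one, aeval_X, aeval_Ypoly]
    exact mul_ne_zero h1.ne' (by linarith)
  · simp [map_prod]

/-- `B` is `ℚ`-semialgebraic on any `ℚ`-semialgebraic subset of the cube. -/
theorem sa_fb : IsSemialgebraicFunOn ℚ S (fun x => fb⟪m, x⟫) := by
  refine (isSemialgebraicFunOn_aeval_div_aeval hS 1 ((1 - Ypoly⟪m⟫ * X 0) * X (Fin.last (m + 1)) *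
    (1 - Ypoly⟪m⟫ * X (Fin.last (m + 1)))) fun x hx => ?_).congr fun x hx => ?_
  · obtain ⟨-, -, hl, -, -, -, h1, h2⟩ := cub_facts hm (hsub hx)
    simp only [map_mul, map_sub, map_one, aeval_X, aeval_Ypoly]
    exact mul_ne_zero (mul_ne_zero h1.ne' hl.ne') h2.ne'
  · simp [map_prod]

/-- `B₁` is `ℚ`-semialgebraic on any `ℚ`-semialgebraic subset of the cube. -/
theorem sa_fb1 : IsSemialgebraicFunOn ℚ S (fun x => fb1⟪m, x⟫) := by
  refine (isSemialgebraicFunOn_aeval_div_aeval hS 1 ((1 - Ypoly⟪m⟫ * X 0) * X (Fin.last (m + 1)))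
    fun x hx => ?_).congr fun x hx => ?_
  · obtain ⟨-, -, hl, -, -, -, h1, -⟩ := cub_facts hm (hsub hx)
    simp only [map_mul, map_sub, map_one, aeval_X, aeval_Ypoly]
    exact mul_ne_zero h1.ne' hl.ne'
  · simp [map_prod]

/-- `B₂` is `ℚ`-semialgebraic on any `ℚ`-semialgebraic subset of the cube. -/
theorem sa_fb2 : IsSemialgebraicFunOn ℚ S (fun x => fb2⟪m, x⟫) := by
  refine (isSemialgebraicFunOn_aeval_div_aeval hS Ypoly⟪m⟫
    ((1 - Ypoly⟪m⟫ * X 0) * (1 - Ypoly⟪m⟫ * X (Fin.last (m + 1)))) fun x hx => ?_).congr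
    fun x hx => ?_
  · obtain ⟨-, -, -, -, -, -, h1, h2⟩ := cub_facts hm (hsub hx)
    simp only [map_mul, map_sub, map_one, aeval_X, aeval_Ypoly]
    exact mul_ne_zero h1.ne' h2.ne'
  · simp [map_prod]

/-- `C'` is `ℚ`-semialgebraic on any `ℚ`-semialgebraic subset of the cube. -/
theorem sa_fc : IsSemialgebraicFunOn ℚ S (fun x => fc⟪m, x⟫) := by
  refine (isSemialgebraicFunOn_aeval_div_aeval hS 1
    (X 0 * (1 - Ypoly⟪m⟫ * X 0) * (1 - Ypoly⟪m⟫ * X (Fin.last (m + 1)))) fun x hx => ?_).congr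
    fun x hx => ?_
  · obtain ⟨h0, -, -, -, -, -, h1, h2⟩ := cub_facts hm (hsub hx)
    simp only [map_mul, map_sub, map_one, aeval_X, aeval_Ypoly]
    exact mul_ne_zero (mul_ne_zero h0.ne' h1.ne') h2.ne'
  · simp [map_prod]

end sa

/-! ### The swap of the fibre coordinates, and a constructor -/

/-- The swap does not change the modulus. -/
theorem ymod_swp (w : Fin (m + 2) → ℝ) : ymod⟪m, fun i => w (swp⟪m⟫ i)⟫ = ymod⟪m, w⟫ :=
  Finset.prod_congr rfl fun i _ => by
    simp only [Equiv.swap_apply_of_ne_of_ne (spec_ne_zero i) (spec_ne_last i)]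

/-- After the swap, `C'` is `B`: `C'(w ∘ swap) = B(w)`. -/
theorem fc_swp (w : Fin (m + 2) → ℝ) : fc⟪m, fun i => w (swp⟪m⟫ i)⟫ = fb⟪m, w⟫ := by
  rw [ymod_swp]
  simp only [Equiv.swap_apply_left, Equiv.swap_apply_right]
  ring

/-- An integral representation with prescribed domain and integrand. -/
theorem exists_rep {n : ℕ} (S : Set (Fin n → ℝ)) (f : (Fin n → ℝ) → ℝ)
    (hS : Literature.ModelTheory.ExponentialFields.IsSemialgebraic ℚ S)
    (hf : IsSemialgebraicFunOn ℚ S f) (hint : IntegrableOn f S volume) :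
    ∃ r : KZ.IntegralRep n, r.domain = S ∧ r.integrand = f :=
  ⟨⟨S, f, hS, hf, hint⟩, rfl, rfl⟩


end Summit.KontsevichZagierPeriods.MzvKernelInKZ.TwoPosets.Landen
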